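import Literature.Barriers.PneNP.GCTOccurrenceObstructions
import Literature.NumberTheory.DiophantineGeometry.SymmetricGroupReps
import HarnessLib

/-!
# Barrier catalogue `ValiantsHypothesis`: GCT in the homogeneous (matrix powering) setting —
no orbit occurrence obstructions prove even superlinear lower bounds (Gesmundo–Ikenmeyer–Panova 2017)

D-0021 barrier entry for the summit `ValiantsHypothesis` (`VP_ℂ ≠ VNP_ℂ`), sub-approach
"geometric complexity theory" (route `ValiantsHypothesis/GCTMult`). The no-go theorems for
occurrence obstructions in the PADDED setting (Ikenmeyer–Panova 2017, Bürgisser–Ikenmeyer–Panova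
2019; tree: `Literature.Barriers.ValiantsHypothesis.GCTOccurrenceObstructions`) and for shifted
partials (ELSW 2018) exploit the padding `X^{n-m} per_m`. GIP remove the padding: replace the
determinant by the trace of a matrix power `Pow^m_n = tr(X^m)` (Nisan's homogenisation), so that
the permanent is compared, in its own degree, with an orbit closure in the same space
`A^m_n = Sym^m ℂ^{n²}`. Technique class: ORBIT occurrence obstructions in this homogeneous setting
— partitions `λ ⊢ dm` occurring in `ℂ[\overline{GL_{n²} per_m}]_d` whose multiplicity
`sm(λ, n)` in the coordinate ring of the ORBIT `GL_{n²} Pow^m_n` vanishes (Cor. 9). The barrier: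
none exists for `n ≥ m + 2 ≥ 12` (Thm. 10), i.e. such obstructions cannot prove `pc(per_m) > m+1`.

**The printed results** (arXiv:1611.00827 = Diff. Geom. Appl. 55 (2017), held, checked with
`lit read`; GIP letters: permanent size `m`, matrix size `n`; everything over `ℂ`).

* §1: `per_m`, `Pow^m_n := tr(X^m)` for an `n × n` matrix `X` of variables; "if `n ≥ m+2 ≥ 12` and
  `λ` occurs in `ℂ[\overline{GL_{n²} per_m}]`, then `λ` also occurs in `ℂ[GL_{n²} Pow^m_n]`".
* §2.1 (padded setting, Props. 2–4; orbit occurrence obstructions `sk(λ, n×d) = 0 < a''_{λ,m}(d[n])`;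
  "no lower bounds better than `dc(per_m) > m^25` can be proved with occurrence obstructions
  [BIP]"; `sk(μ, λ)` = multiplicity of `[μ]` in the symmetric square `S²[λ]`, "the symmetric
  Kronecker coefficients"; §4: `sk(λ, μ) = dim([λ] ⊗ S²[μ])^{S_D}`).
* §2.2 (homogeneous setting): `A^m_n` = forms of degree `m` in `n²` variables; "Let `pc(per_m)`
  denote the smallest `n` such that `per_m` can be written as `p = tr(A^m)`, where `A` is an
  `n × n` matrix whose entries are homogeneous linear forms." "`pc(per_m)` and `dc(per_m)` are
  polynomially equivalent [Nisan] and hence Conj. 1 is equivalent to: the sequence `pc(per_m)`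
  grows superpolynomially"; "`pc(per_m) ≤ 2^m - 1`" (Grenet). Prop. 5: "If
  `\overline{GL_{n²} per_m} ⊄ \overline{GL_{n²} Pow^m_n}`, then `pc(per_m) > n`." Splittings
  `ℂ[\overline{GL_{n²} per_m}]_d = ⊕ V_λ^{q_λ(d[m])}`, `ℂ[\overline{GL_{n²} Pow^m_n}]_d = ⊕ V_λ^{t_{λ,n}(d[m])}`
  ("`q_λ(d[m])` does not depend on `n` for `n ≥ m`"); Cor. 6: `q_λ(d[m]) > t_{λ,n}(d[m]) ⇒ pc(per_m) > n`.
  Thm. 7 (stabiliser of `Pow^m_n`, `n, m ≥ 3`); Thm. 8: "For `n, m ≥ 3` we have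
  `ℂ[GL_{n²} Pow^m_n]_d = ℂ[GL_{n²}]^S_d = ⊕_λ V_λ^{sm(λ,n)}`, where the sum is over all `λ ⊢ md` and
  `sm(λ, n) := Σ_{μ ⊢_n dm} sk(λ, μ)`"; `t_{λ,n}(d[m]) ≤ sm(λ, n)`. Cor. 9: "If `λ ⊢ dm` and
  `sm(λ, n) = 0 < q_λ(d[m])`, then `pc(per_m) > n`. We call these `λ` orbit occurrence
  obstructions." Thm. 10 (Main Result): "Let `m ≥ 10` and `n ≥ m + 2`. For every `λ ⊢ dm` that
  satisfies `q_λ(d[m]) > 0` we have `sm(λ, n) > 0`." "This is the first time that the possibility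
  of superlinear lower bounds is ruled out in geometric complexity theory." Lemma 12:
  `q_λ(d[m]) ≤ a_λ(d[m])`, `ℓ(λ) ≤ m²`, `|λ| = md`. Rem. 11: `Pow^m_n` "is not characterized by
  its stabilizer", unlike the determinant; iterated matrix multiplication would be.
* Abstract: "We prove that in this homogeneous formulation there are no orbit occurrence
  obstructions that prove even superlinear lower bounds on the complexity of the permanent."

**Rendering** (tree letters as in the BIP files: PERMANENT size `n`, MATRIX size `m`, so GIP's
`(m, n)` is our `(n, m)`; threshold `10 ≤ n`, `n + 2 ≤ m`). `per_n` as a degree-`n` form in the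
`m²` lexicographic matrix variables is the sibling PneNP entry's `Literature.Barriers.PneNP.blockPerFormLex n m`
(permanent of the top-left `n × n` block, `CplxAlg.TopBlockIdx`, exactly BIP's embedding without
the padding factor; `Pow` is its `powTracePoly`/`powTraceFormLex`); "`λ ⊢ dn`
occurs in `ℂ[\overline{GL_{m²} per_n}]_d`" is `HasHighestWeight (blockPerOrbitRep n m) (partitionWeightLex m λ)`
(same dual/Borel conventions as the BIP files; the weight pins `d`). The symmetric Kronecker
positivity `sk(λ, μ) > 0` is rendered through the character formula: `skCharSum λ μ =
Σ_σ χ^λ(σ)(χ^μ(σ)² + χ^μ(σ²)) = 2·D!·sk(λ, μ)` (character of `S²[μ]` is `(χ^μ(σ)² + χ^μ(σ²))/2`,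
characters of `S_D` are real and `σ ~ σ⁻¹`), so `SkPos λ μ :↔ skCharSum λ μ ≠ 0`; `sm(λ, m) > 0`
iff some `μ ⊢ dn` with `ℓ(μ) ≤ m` has `SkPos λ μ`. The coordinate ring of the ORBIT of `Pow`
(Peter–Weyl, Thm. 8) is not in the tree; the technique class is therefore Cor. 9's COMBINATORIAL
form (`sm = 0 < q`), which is what Thm. 10 refutes. `pc` is `powTraceComplexity` (`HasPowTraceRepr`).

**What this file does.** Definitions (`HasPowTraceRepr`, `powTraceComplexity`, `blockPerOrbitRep`
(over the PneNP entry's `blockPerFormLex`), `skCharSum`, `SkPos`, `SmPos`, `IsOrbitOccurrenceObstruction` —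
the ORBIT form; the orbit-CLOSURE occurrence conjecture in this setting is the PneNP entry's open
`Literature.Barriers.PneNP.PowOccurrenceObstructionConjecture`, not refuted by GIP); named
facts `GIP2017_thm10` (Main Result), `GIP2017_cor9` (the obstruction principle for orbit occurrence
obstructions), `GIP2017_pc_le` (Grenet's bound for `pc`); the barrier fact `GCTMatrixPowering`
is Thm. 10; PROVED: `GCTMatrixPowering.not_isOrbitOccurrenceObstruction` and the "no superlinear
bound" reading `not_certifies_superlinear` (orbit occurrence obstructions certify `pc(per_n) > m`
only for `m ≤ n + 1` once `n ≥ 10`).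

## References

* [GesmundoIkenmeyerPanova2017] F. Gesmundo, C. Ikenmeyer, G. Panova, *Geometric complexity
  theory and matrix powering*, Diff. Geom. Appl. 55 (2017) 106–127 (arXiv:1611.00827), abstract,
  §1, §2.1 (Props. 2–4), §2.2 (Prop. 5, Cor. 6, Thm. 7, Thm. 8, Cor. 9, Thm. 10, Rem. 11,
  Lemma 12, Props. 13–14), §4 ((4.1)).
* [BurgisserIkenmeyerPanovaJAMS2019] (tree key), [IkenmeyerPanova2017] (tree key) — the padded no-go results.
* [FultonHarrisGTM129] (tree key) §2.1 (characters of symmetric squares), Ex. 4.51.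
-/

noncomputable section

namespace Literature.Barriers.ValiantsHypothesis

open Literature.NumberTheory.DiophantineGeometry Literature.Computability.AlgebraicComplexity Literature.Computability.Complexity MvPolynomial

/-! ### The homogeneous model: traces of matrix powers -/

section Model

variable (k : Type*) [Field k]

/-- `HasPowTraceRepr f n m`: `f = tr(A^n)` for an `m × m` matrix `A` of homogeneous linear forms.
[cite: GesmundoIkenmeyerPanova2017, §2.2 (definition of pc)] -/
def HasPowTraceRepr {σ : Type*} (f : MvPolynomial σ k) (n m : ℕ) : Prop :=
  ∃ A : Matrix (Fin m) (Fin m) (MvPolynomial σ k), (∀ i j, (A i j).IsHomogeneous 1) ∧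
    (A ^ n).trace = f

/-- `pc(f)` (for the degree `n`): the least `m` with `f = tr(A^n)`, `A` an `m × m` matrix of
homogeneous linear forms; junk `0` (`sInf ∅`) if no such representation exists. For `f = per_n`
one exists with `m ≤ 2^n - 1` (Grenet, `GIP2017_pc_le`). "`pc(per_m)` and `dc(per_m)` are
polynomially equivalent". [cite: GesmundoIkenmeyerPanova2017, §2.2] -/
def powTraceComplexity {σ : Type*} (f : MvPolynomial σ k) (n : ℕ) : ℕ :=
  sInf {m | HasPowTraceRepr k f n m}

/-- The `GL_{m²}`-representation on the coordinate ring `ℂ[\overline{GL_{m²} · per_n}]` (G20's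
`orbitCoordRep`, degree `n`) of the UNPADDED block permanent of the sibling entry
`Literature.Barriers.PneNP.GCTOccurrenceObstructions` (`Literature.Barriers.PneNP.blockPerFormLex n m`:
`per_n` on the top-left `n × n` block of the generic `m × m` matrix, lexicographic variables):
GIP's `⊕_d ⊕_λ V_λ^{q_λ(d[m])}` (letters swapped). The matrix power trace `Pow` is that file's
`Literature.Barriers.PneNP.powTracePoly m n` / `powTraceFormLex`. [cite: GesmundoIkenmeyerPanova2017, §2.2 (the splitting defining q_λ)] -/
def blockPerOrbitRep (n m : ℕ) :
    Representation ℂ (GL (MatIdx m) ℂ) (OrbitCoordRing (Literature.Barriers.PneNP.blockPerFormLex n m) n) :=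
  orbitCoordRep (Literature.Barriers.PneNP.blockPerFormLex n m) n

end Model

/-! ### Symmetric Kronecker positivity via characters -/

section SymKronecker

variable {D : ℕ}

/-- The character sum `Σ_{σ ∈ S_D} χ^λ(σ) · (χ^μ(σ)² + χ^μ(σ²))`, over `ℂ`. By the character of a
symmetric square, `χ_{S²[μ]}(σ) = (χ^μ(σ)² + χ^μ(σ²))/2`, and the multiplicity formula
`mult([λ], W) = (1/D!) Σ_σ χ^λ(σ⁻¹) χ_W(σ)` with `χ^λ(σ⁻¹) = χ^λ(σ)` (`σ ~ σ⁻¹` in `S_D`), this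
equals `2 · D! · sk(λ, μ)`, `sk(λ, μ) = dim([λ] ⊗ S²[μ])^{S_D}` the symmetric Kronecker
coefficient (multiplicity of `[λ]` in `S²[μ]`). [cite: GesmundoIkenmeyerPanova2017, §2.1 and §4 (sk)] [cite: FultonHarrisGTM129, §2.1 and Ex. 4.51] -/
def skCharSum (lam μ : Nat.Partition D) : ℂ :=
  ∑ σ : Equiv.Perm (Fin D),
    spechtCharacter ℂ lam σ * (spechtCharacter ℂ μ σ ^ 2 + spechtCharacter ℂ μ (σ * σ))

/-- `SkPos λ μ`: the symmetric Kronecker coefficient `sk(λ, μ)` is positive, rendered as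
`skCharSum λ μ ≠ 0` (`= 2·D!·sk(λ, μ)` with `sk ∈ ℕ`). Design note: here the character identity is
taken as the DEFINITION of positivity (no symmetric square of a representation in the tree),
whereas the tree's `CplxAlg.kroneckerCoeff` is a Hom-dimension with its character formula a
separate named fact. [cite: GesmundoIkenmeyerPanova2017, §2.1 (sk)] -/
def SkPos (lam μ : Nat.Partition D) : Prop :=
  skCharSum lam μ ≠ 0

/-- `SmPos m λ`: GIP's `sm(λ, n) = Σ_{μ ⊢_n |λ|} sk(λ, μ) > 0` (letters swapped: matrix size `m`),
i.e. some partition `μ` of `|λ|` with at most `m` parts has `sk(λ, μ) > 0` — by Thm. 8 the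
multiplicity of `V_λ` in the coordinate ring of the orbit `GL_{m²} · Pow`.
[cite: GesmundoIkenmeyerPanova2017, Thm. 8 (definition of sm)] -/
def SmPos (m : ℕ) (lam : Nat.Partition D) : Prop :=
  ∃ μ : Nat.Partition D, μ.parts.card ≤ m ∧ SkPos lam μ

end SymKronecker

/-! ### The technique class: orbit occurrence obstructions in the homogeneous setting -/

/-- **Technique class (GIP Cor. 9).** `λ ⊢ d·n` is an *orbit occurrence obstruction* against
`per_n ∈ \overline{GL_{m²} · Pow^n_m}`: `λ` occurs in `ℂ[\overline{GL_{m²} per_n}]_d`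
(`q_λ(d[n]) > 0`) while `sm(λ, m) = 0` — so `t_{λ,m} ≤ sm(λ, m) = 0 < q_λ` and `pc(per_n) > m`
(Cor. 9, `GIP2017_cor9`). The side condition `ℓ(λ) ≤ m²` (Lemma 12, automatic in print) is carried
for the truncating `Weight.dualOfPartition`. [cite: GesmundoIkenmeyerPanova2017, Cor. 9 ("We call these λ orbit occurrence obstructions")] -/
def IsOrbitOccurrenceObstruction (n m : ℕ) {d : ℕ} (lam : Nat.Partition (d * n)) : Prop :=
  lam.parts.card ≤ m * m ∧
    HasHighestWeight (blockPerOrbitRep n m) (partitionWeightLex m lam) ∧ ¬ SmPos m lam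

/-! ### The printed results as named facts (D-0014) -/

/-- **Gesmundo–Ikenmeyer–Panova 2017, Thm. 10 (Main Result).** "Let `m ≥ 10` and `n ≥ m + 2`.
For every `λ ⊢ dm` that satisfies `q_λ(d[m]) > 0` we have `sm(λ, n) > 0`." Tree letters
(permanent `n ≥ 10`, matrix size `m ≥ n + 2`): every `λ ⊢ d·n` with at most `m²` parts occurring
in `ℂ[\overline{GL_{m²} per_n}]` has `sm(λ, m) > 0`. [cite: GesmundoIkenmeyerPanova2017, Thm. 10] -/
def GIP2017_thm10 : Prop :=
  ∀ (n m d : ℕ), 10 ≤ n → n + 2 ≤ m → ∀ lam : Nat.Partition (d * n), lam.parts.card ≤ m * m →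
    HasHighestWeight (blockPerOrbitRep n m) (partitionWeightLex m lam) → SmPos m lam

/-- **GIP Cor. 9 (the obstruction principle for orbit occurrence obstructions).** "If `λ ⊢ dm`
and `sm(λ, n) = 0 < q_λ(d[m])`, then `pc(per_m) > n`" (from Prop. 5, Schur's lemma and
`t_{λ,n} ≤ sm(λ, n)`, Thm. 8; needs `n, m ≥ 3`). Tree letters, with `pc` = `powTraceComplexity`
of `per_n` in degree `n`. [cite: GesmundoIkenmeyerPanova2017, Cor. 9 (with Prop. 5, Cor. 6, Thm. 8)] -/
def GIP2017_cor9 : Prop :=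
  ∀ (n m d : ℕ), 3 ≤ n → 3 ≤ m → ∀ lam : Nat.Partition (d * n),
    IsOrbitOccurrenceObstruction n m lam → m < powTraceComplexity ℂ (perPoly (Fin n) ℂ) n

/-- **Grenet's bound in the homogeneous model:** "the proof of the best known upper bound
`dc(per_m) ≤ 2^m - 1` by Grenet also works for this measure: `pc(per_m) ≤ 2^m - 1`" (`m ≥ 1`).
[cite: GesmundoIkenmeyerPanova2017, §2.2] -/
def GIP2017_pc_le : Prop :=
  ∀ n : ℕ, 1 ≤ n → HasPowTraceRepr ℂ (perPoly (Fin n) ℂ) n (2 ^ n - 1)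

/-! ### The barrier fact and the no-go theorems -/

/-- **GCT and matrix powering (Gesmundo–Ikenmeyer–Panova 2017).** The barrier fact is Thm. 10.

BARRIER
technique_class: GCT, orbit-occurrence-obstructions, homogeneous-setting, padding-free, matrix-powering, symmetric-Kronecker-vanishing
blocks: orbit occurrence obstructions in the HOMOGENEOUS (padding-free) setting `per_m` versus `Pow^m_n = tr(X^m)` (`IsOrbitOccurrenceObstruction`: `λ` occurs in `ℂ[\overline{GL per_m}]_d` but has multiplicity `sm(λ, n) = 0` in the coordinate ring of the orbit of `Pow^m_n`) as a way of proving `pc(per_m)` superpolynomial — equivalent to `dc(per_m)` superpolynomial and to `ValiantsHypothesis` in the form `VP_ws ≠ VNP` ("`pc(per_m)` and `dc(per_m)` are polynomially equivalent") [cite: GesmundoIkenmeyerPanova2017, §2.2] (obstruction principle Cor. 9, `GIP2017_cor9`): for `m ≥ 10` and every `n ≥ m + 2` no such obstruction exists (`GCTMatrixPowering.not_isOrbitOccurrenceObstruction`, proved), so they certify at best `pc(per_m) > m + 1` (`GCTMatrixPowering.not_certifies_superlinear`, proved), "no orbit occurrence obstructions that prove even superlinear lower bounds on the complexity of the permanent"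 [cite: GesmundoIkenmeyerPanova2017, abstract and Thm. 10]; this closes the padding loophole of the earlier no-go theorems, which "crucially" used the padding (Kadish–Landsberg `λ₁ ≥ (n-m)d`, Prop. 4) [cite: GesmundoIkenmeyerPanova2017, §2.1].
because: an occurring `λ ⊢ dm` has `ℓ(λ) ≤ m²` and `a_λ(d[m]) > 0` (Lemma 12), hence `λ₁ ≥ m` since plethysm coefficients `a_λ(d[m])` vanish for `λ₁ < m` (Prop. 13); the stabiliser of `Pow^m_n` is generated by transposition, conjugation `X ↦ gXg⁻¹` and `m`-th roots of unity (Thm. 7), so by the algebraic Peter–Weyl theorem the orbit's coordinate ring has multiplicities `sm(λ, n) = Σ_{μ ⊢_n dm} sk(λ, μ)` (Thm. 8), and a positivity result for symmetric Kronecker coefficients (Prop. 14: `λ ⊢ md`, `λ₁ ≥ 3`, `ℓ(λ) ≤ m²`, `n ≥ m + 2 ⇒ sm(λ, n) > 0`) finishes [cite: GesmundoIkenmeyerPanova2017, §2.2 (proof of Thm. 10: Lemma 12, Props. 13–14, Thms. 7–8)].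
evasions_known: multiplicity obstructions `q_λ(d[m]) > t_{λ,n}(d[m])` (Cor. 6) are not excluded, nor are occurrence obstructions with respect to the orbit CLOSURE of `Pow^m_n` (`t_{λ,n} = 0 < q_λ` with `sm(λ, n) > 0`), since only the orbit's multiplicities `sm ≥ t` are shown positive [cite: GesmundoIkenmeyerPanova2017, Cor. 6, Thm. 8 and Thm. 10]; a homogeneous setting whose model IS characterised by its stabiliser — the orbit closure of iterated matrix multiplication — is proposed as "even more challenging" [cite: GesmundoIkenmeyerPanova2017, Rem. 11].
scope_caveats: the theorem is for `m ≥ 10`, `n ≥ m + 2` only — it does not address `n ∈ {m, m+1}` (so literally "superlinear" means beyond `m + 1`), and says nothing about multiplicities; "the arguments remain valid if the permanent is replaced by any other VNP-complete function, mutatis mutandis" is a remark, not vendored [cite: GesmundoIkenmeyerPanova2017, §2 (Introduction)]; the Lean technique class is the combinatorial form of Cor. 9 (`sm = 0`, through the character formula for `sk`) because the coordinate ring of the orbit (Thm. 8) is not in the tree, and `GIP2017_cor9` (which rests on Thm. 8 and Prop. 5) is a named fact; tree letters swap GIP's `m, n`.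
status: theorem (established) [cite: GesmundoIkenmeyerPanova2017, Thm. 10] -/
def GCTMatrixPowering : Prop :=
  GIP2017_thm10

/-- Unfolding of the barrier fact. [folklore] -/
theorem gctMatrixPowering_iff : GCTMatrixPowering ↔ GIP2017_thm10 :=
  Iff.rfl

/-- **No orbit occurrence obstructions for `n ≥ 10`, `m ≥ n + 2`** (tree letters).
[cite: GesmundoIkenmeyerPanova2017, Thm. 10] -/
theorem GCTMatrixPowering.not_isOrbitOccurrenceObstruction (h : GCTMatrixPowering) {n m d : ℕ}
    (hn : 10 ≤ n) (hm : n + 2 ≤ m) (lam : Nat.Partition (d * n)) :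
    ¬ IsOrbitOccurrenceObstruction n m lam :=
  fun ⟨hcard, hocc, hsm⟩ => hsm (h n m d hn hm lam hcard hocc)

/-- **"No superlinear lower bounds":** for `n ≥ 10`, if an orbit occurrence obstruction exists at
matrix size `m`, then `m ≤ n + 1`. [cite: GesmundoIkenmeyerPanova2017, abstract and Thm. 10] -/
theorem GCTMatrixPowering.not_certifies_superlinear (h : GCTMatrixPowering) {n m d : ℕ}
    (hn : 10 ≤ n) (lam : Nat.Partition (d * n)) (hobs : IsOrbitOccurrenceObstruction n m lam) :
    m ≤ n + 1 := by
  by_contra hlt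
  exact h.not_isOrbitOccurrenceObstruction hn (by omega) lam hobs

/-- Consequently the lower bounds on `pc(per_n)` obtainable from orbit occurrence obstructions via
Cor. 9 are at most `pc(per_n) > n + 1`: whatever matrix size `m` an obstruction certifies,
`m ≤ n + 1` (`n ≥ 10`). [cite: GesmundoIkenmeyerPanova2017, Cor. 9 and Thm. 10] -/
theorem GCTMatrixPowering.certified_bound_le (h : GCTMatrixPowering) (h9 : GIP2017_cor9) {n m d : ℕ}
    (hn : 10 ≤ n) (hm : 3 ≤ m) (lam : Nat.Partition (d * n))
    (hobs : IsOrbitOccurrenceObstruction n m lam) :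
    m < powTraceComplexity ℂ (perPoly (Fin n) ℂ) n ∧ m ≤ n + 1 :=
  ⟨h9 n m d (by omega) hm lam hobs, h.not_certifies_superlinear hn lam hobs⟩

end Literature.Barriers.ValiantsHypothesis
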